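import Mathlib
import HarnessLib
import Summits.Ventures.LatticeQCDFlow.Scoring.GlivenkoCantelliRate

/-!
# A finite-sample band for ALL SAMPLE QUANTILES at once: on the Glivenko–Cantelli band event
# every empirical quantile is bracketed by population quantiles at shifted levels,
# `q_F(u − ε) ≤ q̂ₙ(u) ≤ q_F(u + ε)` for all `u ∈ (ε, 1 − ε)`, except with probability at most
# `2(⌈2/ε⌉ + 1)·e^{−nε²/2}`

HONEST FRAMING: exact (Metropolis-corrected) sampling algorithms for lattice gauge theory;
figures of merit are autocorrelation/cost numbers at stated couplings and volumes; no
continuum-physics claim.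

Venture `LatticeQCDFlow` (cell pub-lqcd), topic `Scoring`; FANOUT row 4 (`s0-u1-b`, rung S0-B).
The printed card reports medians and percentiles; `Scoring/SampleQuantileConsistency` proved
them consistent and claimed no rate.  This file turns the finite-sample uniform band of
`Scoring/GlivenkoCantelliRate` into a simultaneous finite-sample statement about every sample
quantile.  Two deterministic facts carry it: (1) **`quantile_bracket_of_abs_cdf_sub_lt`** — for
two probability measures `ρ, ν` on `ℝ` whose distribution functions are uniformly `δ`-close,
the lower quantiles satisfy `q_ρ(u − δ) ≤ q_ν(u) ≤ q_ρ(u + δ)` for `δ < u < 1 − δ` (twice the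
Galois connection `q(v) ≤ b ↔ v ≤ F(b)` of `Scoring/GlivenkoCantelliSandwich.cdf_quantile_spec`);
(2) **`cdf_empiricalMeasure`** — the distribution function of the empirical probability measure
`n⁻¹ Σ_{i<n} δ_{Xᵢ}` is the empirical distribution function `#{i<n : Xᵢ ≤ t}/n`.  With
`ν` the empirical measure, **`measureReal_exists_quantile_unbracketed_le`**:
`P(∃ u ∈ (ε, 1 − ε), q̂ₙ(u) ∉ [q_F(u − ε), q_F(u + ε)]) ≤ 2(⌈2/ε⌉ + 1)e^{−nε²/2}`.
NEW WORK of the cell; no definition; nothing cited as a fact.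

## Content

* `quantile_bracket_of_abs_cdf_sub_lt` — deterministic, two measures;
* `isProbabilityMeasure_empiricalMeasure`, `cdf_empiricalMeasure`;
* **`measureReal_exists_quantile_unbracketed_le`** — the simultaneous quantile band.

NOT CLAIMED: a band in the VALUE scale (`|q̂ₙ(u) − q_F(u)|`, which needs local growth of `F`);
the reweighted card's quantiles; dependent samples.
-/

noncomputable section

namespace Summit.Ventures.LatticeQCDFlow.Scoring.GlivenkoCantelli

open MeasureTheory ProbabilityTheory Finset Filter Function
open scoped Topology ENNReal

/-! ## §1 Close distribution functions have bracketing quantiles -/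

section Deterministic

/-- **CLOSE DISTRIBUTION FUNCTIONS BRACKET EACH OTHER'S QUANTILES.**  `ρ, ν` probability
measures on `ℝ` with `|cdf ρ t − cdf ν t| < δ` for every `t`; `δ < u`, `u + δ < 1`.  Then the
lower quantiles `q_μ(v) = inf{x : v ≤ cdf μ x}` satisfy
`q_ρ(u − δ) ≤ q_ν(u) ≤ q_ρ(u + δ)`. [ours] (the Galois connection `q(v) ≤ b ↔ v ≤ F(b)` twice) -/
theorem quantile_bracket_of_abs_cdf_sub_lt (ρ ν : Measure ℝ) [IsProbabilityMeasure ρ]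
    [IsProbabilityMeasure ν] {δ u : ℝ} (hδ : 0 < δ) (hδu : δ < u) (huδ : u + δ < 1)
    (h : ∀ t, |cdf ρ t - cdf ν t| < δ) :
    sInf {x | u - δ ≤ cdf ρ x} ≤ sInf {x | u ≤ cdf ν x}
      ∧ sInf {x | u ≤ cdf ν x} ≤ sInf {x | u + δ ≤ cdf ρ x} := by
  have hu0 : 0 < u := hδ.trans hδu
  have hu1 : u < 1 := by linarith
  obtain ⟨hνu, -, hgalν⟩ := cdf_quantile_spec ν hu0 hu1
  obtain ⟨-, -, hgal₁⟩ := cdf_quantile_spec ρ (sub_pos.2 hδu) (by linarith : u - δ < 1)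
  obtain ⟨hρ₂, -, -⟩ := cdf_quantile_spec ρ (by linarith : 0 < u + δ) huδ
  constructor
  · -- `u − δ ≤ F_ρ(q_ν(u))` since `F_ρ > F_ν − δ ≥ u − δ` there
    refine (hgal₁ _).2 ?_
    have ht := abs_sub_lt_iff.1 (h (sInf {x | u ≤ cdf ν x}))
    linarith [ht.2]
  · -- `u ≤ F_ν(q_ρ(u + δ))` since `F_ν > F_ρ − δ ≥ u` there
    refine (hgalν _).2 ?_
    have ht := abs_sub_lt_iff.1 (h (sInf {x | u + δ ≤ cdf ρ x}))
    linarith [ht.1]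

end Deterministic

/-! ## §2 The empirical measure and its distribution function -/

section Empirical

/-- The empirical measure `n⁻¹ Σ_{i<n} δ_{xᵢ}` of `n ≥ 1` points is a probability measure.
[folklore] -/
theorem isProbabilityMeasure_empiricalMeasure (x : ℕ → ℝ) {n : ℕ} (hn : 1 ≤ n) :
    IsProbabilityMeasure (((n : ℝ≥0∞)⁻¹) • ∑ i ∈ range n, Measure.dirac (x i)) := by
  refine ⟨?_⟩
  rw [Measure.smul_apply, Measure.finsetSum_apply]
  simp only [measure_univ, Finset.sum_const, Finset.card_range, nsmul_eq_mul, mul_one,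
    smul_eq_mul]
  have hn0 : (n : ℝ≥0∞) ≠ 0 := by exact_mod_cast (by omega : n ≠ 0)
  exact ENNReal.inv_mul_cancel hn0 (ENNReal.natCast_ne_top n)

/-- **The distribution function of the empirical measure is the empirical distribution
function**: `cdf(n⁻¹ Σ_{i<n} δ_{xᵢ})(t) = #{i<n : xᵢ ≤ t}/n` for `n ≥ 1`. [folklore] -/
theorem cdf_empiricalMeasure (x : ℕ → ℝ) {n : ℕ} (hn : 1 ≤ n) (t : ℝ) :
    cdf (((n : ℝ≥0∞)⁻¹) • ∑ i ∈ range n, Measure.dirac (x i)) t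
      = (∑ i ∈ range n, (Set.Iic t).indicator (1 : ℝ → ℝ) (x i)) / n := by
  haveI := isProbabilityMeasure_empiricalMeasure x hn
  rw [cdf_eq_real, measureReal_def, Measure.smul_apply, Measure.finsetSum_apply, smul_eq_mul,
    ENNReal.toReal_mul, ENNReal.toReal_inv, ENNReal.toReal_natCast, ENNReal.toReal_sum
      (fun i _ => measure_ne_top _ _), inv_mul_eq_div]
  congr 1
  refine Finset.sum_congr rfl fun i _ => ?_
  rw [Measure.dirac_apply' _ measurableSet_Iic]
  by_cases hx : x i ∈ Set.Iic t
  · rw [Set.indicator_of_mem hx, Set.indicator_of_mem hx]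
    simp
  · rw [Set.indicator_of_notMem hx, Set.indicator_of_notMem hx]
    simp

end Empirical

/-! ## §3 The simultaneous quantile band -/

section Band

variable {Ω : Type*} [MeasurableSpace Ω] {P : Measure Ω} [IsProbabilityMeasure P] {X : ℕ → Ω → ℝ}

/-- **ALL SAMPLE QUANTILES AT ONCE.**  iid real `Xᵢ` with law `ρ = P ∘ X₀⁻¹`, population lower
quantiles `q_F(v) = inf{x : v ≤ cdf ρ x}`, empirical lower quantiles
`q̂ₙ(u) = inf{x : u ≤ cdf(n⁻¹Σ_{i<n} δ_{Xᵢ}) x}` (the usual order-statistic quantile); `ε > 0`,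
`n ≥ 1`.  Then
`P(∃ u, ε < u ∧ u + ε < 1 ∧ ¬(q_F(u − ε) ≤ q̂ₙ(u) ≤ q_F(u + ε))) ≤ 2(⌈2/ε⌉ + 1)·e^{−nε²/2}`.
[ours] (on the complement of the Glivenko–Cantelli band event every bracket holds, by
`quantile_bracket_of_abs_cdf_sub_lt` applied to `ρ` and the empirical measure) -/
theorem measureReal_exists_quantile_unbracketed_le (hXm : ∀ i, Measurable (X i))
    (hind : iIndepFun X P) (hid : ∀ i, IdentDistrib (X i) (X 0) P P) {ε : ℝ} (hε : 0 < ε)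
    {n : ℕ} (hn : 1 ≤ n) :
    P.real {ω | ∃ u : ℝ, ε < u ∧ u + ε < 1 ∧
        ¬ (sInf {x | u - ε ≤ cdf (P.map (X 0)) x}
              ≤ sInf {x | u ≤ cdf (((n : ℝ≥0∞)⁻¹) • ∑ i ∈ range n, Measure.dirac (X i ω)) x}
            ∧ sInf {x | u ≤ cdf (((n : ℝ≥0∞)⁻¹) • ∑ i ∈ range n, Measure.dirac (X i ω)) x}
              ≤ sInf {x | u + ε ≤ cdf (P.map (X 0)) x})}
      ≤ 2 * ((⌈2 / ε⌉₊ : ℝ) + 1) * Real.exp (-(n * ε ^ 2 / 2)) := by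
  haveI : IsProbabilityMeasure (P.map (X 0)) :=
    Measure.isProbabilityMeasure_map (hXm 0).aemeasurable
  refine le_trans (measureReal_mono ?_ (measure_ne_top P _))
    (measureReal_exists_edf_dev_ge_le_of_pos hXm hind hid hε hn)
  rintro ω ⟨u, hεu, huε, hnot⟩
  by_contra hgood
  simp only [Set.mem_setOf_eq, not_exists, not_le] at hgood
  haveI := isProbabilityMeasure_empiricalMeasure (fun i => X i ω) hn
  refine hnot (quantile_bracket_of_abs_cdf_sub_lt (P.map (X 0))
    (((n : ℝ≥0∞)⁻¹) • ∑ i ∈ range n, Measure.dirac (X i ω)) hε hεu huε fun t => ?_)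
  rw [cdf_empiricalMeasure (fun i => X i ω) hn t]
  exact hgood t

end Band

end Summit.Ventures.LatticeQCDFlow.Scoring.GlivenkoCantelli

end
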